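import Literature.Analysis.FluidPDE.PassiveScalarSpectralBounds
import Literature.Analysis.FunctionSpaces.TorusVectorParseval
import Literature.Analysis.FunctionSpaces.TorusSpectralWeakDerivative
import Literature.Analysis.FunctionSpaces.TorusFourierModes
import Literature.Analysis.FunctionSpaces.TorusFourierCalculus
import HarnessLib

/-!
# Stub `stub_greenCS` of line `Sketch` (crux stmt-AnomalousDissipation-15510, `EnsembleRigidity.ResidualTransferSSS`)

**The `Ḣ¹ × Ḣ¹` pairing bound for vector fields on `T^d` (rough against smooth).** For
`v ∈ L²(T^d; ℝ^d)` and a smooth field `w`,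

  `‖∫ ⟪v, Δw⟫‖ₑ ≤ (eGradNormSq v)^{1/2} (eGradNormSq w)^{1/2}`        (`enorm_integral_inner_laplacian_le`)

in `ℝ≥0∞` with NO finiteness hypothesis (`eGradNormSq` is the spectral enstrophy
`4π² ∑ₖ |k|² ‖v̂(k)‖²`), and its real form for `v` of finite spectral enstrophy,

  `|∫ ⟪v, Δw⟫| ≤ ((eGradNormSq v).toReal)^{1/2} (gradNormSq w)^{1/2}`      (`stub_greenCS`),

the registered stub of the crux skeleton (`gradNormSq w = ∫ ∑ᵢ ‖∂ᵢw‖²` is the classical enstrophy of the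
smooth field, `Torus.eGradNormSq_eq_ofReal_gradNormSq`). This is the quantitative Cauchy–Schwarz form of
Foias–Manley–Rosa–Temam 2001, Ch. IV §1.1, display after (1.10): `(Au, v) = ((u, v))` for
`u, v ∈ V = D(A^{1/2})`, valid for a merely `L²` field `v` against a smooth `w`.

Proof: the vector twin, line by line, of the tree's scalar `Torus.enorm_integral_mul_laplacian_le`
(`PassiveScalarSpectralBounds`): polarised Parseval for real vector fields
(`Torus.hasSum_inner_mFourierCoeff_complexify`), `𝓕(Δw)(k) = −4π²|k|² ŵ(k)`
(`Torus.mFourierCoeff_complexify_laplacian`), `|⟪a, b⟫| ≤ ‖a‖ ‖b‖` termwise with the weight `4π²|k|²`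
split evenly, and Cauchy–Schwarz in `ℓ²` (`ennreal_tsum_mul_le_sqrt_mul_sqrt`).

## References

* C. Foias, O. Manley, R. Rosa, R. Temam, *Navier–Stokes Equations and Turbulence* (CUP 2001),
  Ch. IV §1.1, display after (1.10). [FoiasManleyRosaTemam2001]
* L. Grafakos, *Classical Fourier Analysis* (2014), Prop. 3.2.6 (8), Prop. 3.2.7 (3). [Grafakos2014]
-/

-- `Summit.<Summit>.<Problem>` is the tree's mandated summit-side namespace (CONVENTIONS §2); single-conjunct summit, duplicate deliberate.
set_option linter.dupNamespace false

noncomputable section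

namespace Summit.AnomalousDissipation.AnomalousDissipation.Theorems.ResidualTransferSSS

open MeasureTheory Filter Topology UnitAddTorus
open scoped InnerProductSpace RealInnerProductSpace ENNReal NNReal
open Literature.Analysis.FunctionSpaces Literature.Analysis.FluidPDE

variable {d : Type*} [Fintype d] [DecidableEq d]

omit [DecidableEq d] in
/-- `eGradNormSq v = ∑ₖ ((4π²|k|²)^{1/2} ‖v̂(k)‖ₑ)²` — the spectral enstrophy of a real vector field with
the weight moved inside the square (vector analogue of `Torus.eScalarGradNormSq_eq_tsum'`). [folklore] -/
theorem eGradNormSq_eq_tsum_sq (v : UnitAddTorus d → EuclideanSpace ℝ d) :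
    Torus.eGradNormSq v = ∑' k : d → ℤ,
      (ENNReal.ofReal (4 * Real.pi ^ 2 * Torus.freqNormSq k) ^ (1 / 2 : ℝ) *
        ‖mFourierCoeff (EuclideanSpace.complexify ∘ v) k‖ₑ) ^ 2 := by
  rw [Torus.eGradNormSq_eq_tsum, ← ENNReal.tsum_mul_left]
  refine tsum_congr fun k => ?_
  rw [mul_pow]
  have e : (ENNReal.ofReal (4 * Real.pi ^ 2 * Torus.freqNormSq k) ^ (1 / 2 : ℝ)) ^ 2 =
      ENNReal.ofReal (4 * Real.pi ^ 2 * Torus.freqNormSq k) := by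
    rw [← ENNReal.rpow_natCast, ← ENNReal.rpow_mul]
    norm_num
  rw [e, show ENNReal.ofReal (4 * Real.pi ^ 2 * Torus.freqNormSq k) =
      ENNReal.ofReal (4 * Real.pi ^ 2) * ENNReal.ofReal (Torus.freqNormSq k) from
    ENNReal.ofReal_mul (by positivity), mul_assoc]

/-- **The `Ḣ¹ × Ḣ¹` pairing bound for vector fields** (rough against smooth, extended form): for
`v ∈ L²(T^d; ℝ^d)` and smooth `w`, `‖∫ ⟪v, Δw⟫‖ₑ ≤ (eGradNormSq v)^{1/2} (eGradNormSq w)^{1/2}` — polarised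
Parseval, `𝓕(Δw)(k) = −4π²|k|² ŵ(k)`, and Cauchy–Schwarz in `ℓ²`; no finiteness hypothesis
(FMRT 2001, Ch. IV §1.1, `(Au, v) = ((u, v))` on `V`, quantified). [folklore] -/
theorem enorm_integral_inner_laplacian_le {v w : UnitAddTorus d → EuclideanSpace ℝ d}
    (hv : MemLp v 2 volume) (hw : Torus.IsSmooth w) :
    ‖∫ x, ⟪v x, Torus.laplacian w x⟫_ℝ‖ₑ ≤
      Torus.eGradNormSq v ^ (1 / 2 : ℝ) * Torus.eGradNormSq w ^ (1 / 2 : ℝ) := by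
  have hΔ : MemLp (Torus.laplacian w) 2 volume := hw.laplacian.memLp 2
  have hP := Torus.hasSum_inner_mFourierCoeff_complexify hv hΔ
  -- the weights
  set c : (d → ℤ) → ℝ≥0∞ := fun k => ENNReal.ofReal (4 * Real.pi ^ 2 * Torus.freqNormSq k) with hc
  have hterm : ∀ k : d → ℤ,
      ‖inner ℂ (mFourierCoeff (EuclideanSpace.complexify ∘ v) k)
          (mFourierCoeff (EuclideanSpace.complexify ∘ Torus.laplacian w) k)‖ₑ ≤
        (c k ^ (1 / 2 : ℝ) * ‖mFourierCoeff (EuclideanSpace.complexify ∘ v) k‖ₑ) *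
          (c k ^ (1 / 2 : ℝ) * ‖mFourierCoeff (EuclideanSpace.complexify ∘ w) k‖ₑ) := by
    intro k
    rw [Torus.mFourierCoeff_complexify_laplacian hw k, inner_neg_right, enorm_neg, inner_smul_right,
      enorm_mul]
    have e1 : ‖((4 * Real.pi ^ 2 * Torus.freqNormSq k : ℝ) : ℂ)‖ₑ = c k := by
      rw [← ofReal_norm, Complex.norm_real, Real.norm_eq_abs,
        abs_of_nonneg (by have := Torus.freqNormSq_nonneg k; positivity)]
    rw [e1]
    have e2 : c k ^ (1 / 2 : ℝ) * c k ^ (1 / 2 : ℝ) = c k := by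
      rw [← ENNReal.rpow_add_of_nonneg _ _ (by norm_num) (by norm_num)]; norm_num
    have hin : ‖inner ℂ (mFourierCoeff (EuclideanSpace.complexify ∘ v) k)
        (mFourierCoeff (EuclideanSpace.complexify ∘ w) k)‖ₑ ≤
        ‖mFourierCoeff (EuclideanSpace.complexify ∘ v) k‖ₑ *
          ‖mFourierCoeff (EuclideanSpace.complexify ∘ w) k‖ₑ := by
      rw [← ofReal_norm, ← ofReal_norm, ← ofReal_norm, ← ENNReal.ofReal_mul (norm_nonneg _)]
      exact ENNReal.ofReal_le_ofReal (norm_inner_le_norm _ _)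
    calc c k * ‖inner ℂ (mFourierCoeff (EuclideanSpace.complexify ∘ v) k)
          (mFourierCoeff (EuclideanSpace.complexify ∘ w) k)‖ₑ
        ≤ c k * (‖mFourierCoeff (EuclideanSpace.complexify ∘ v) k‖ₑ *
            ‖mFourierCoeff (EuclideanSpace.complexify ∘ w) k‖ₑ) := by gcongr
      _ = (c k ^ (1 / 2 : ℝ) * c k ^ (1 / 2 : ℝ)) *
            ‖mFourierCoeff (EuclideanSpace.complexify ∘ v) k‖ₑ *
              ‖mFourierCoeff (EuclideanSpace.complexify ∘ w) k‖ₑ := by rw [e2, mul_assoc]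
      _ = _ := by ring
  calc ‖∫ x, ⟪v x, Torus.laplacian w x⟫_ℝ‖ₑ
      = ‖((∫ x, ⟪v x, Torus.laplacian w x⟫_ℝ : ℝ) : ℂ)‖ₑ := by
        rw [← ofReal_norm, ← ofReal_norm, Complex.norm_real]
    _ = ‖∑' k : d → ℤ, inner ℂ (mFourierCoeff (EuclideanSpace.complexify ∘ v) k)
          (mFourierCoeff (EuclideanSpace.complexify ∘ Torus.laplacian w) k)‖ₑ := by
        rw [hP.tsum_eq]
    _ ≤ ∑' k : d → ℤ, ‖inner ℂ (mFourierCoeff (EuclideanSpace.complexify ∘ v) k)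
          (mFourierCoeff (EuclideanSpace.complexify ∘ Torus.laplacian w) k)‖ₑ :=
        enorm_tsum_le_tsum_enorm
    _ ≤ ∑' k : d → ℤ, (c k ^ (1 / 2 : ℝ) * ‖mFourierCoeff (EuclideanSpace.complexify ∘ v) k‖ₑ) *
          (c k ^ (1 / 2 : ℝ) * ‖mFourierCoeff (EuclideanSpace.complexify ∘ w) k‖ₑ) :=
        ENNReal.tsum_le_tsum hterm
    _ ≤ (∑' k : d → ℤ, (c k ^ (1 / 2 : ℝ) * ‖mFourierCoeff (EuclideanSpace.complexify ∘ v) k‖ₑ) ^ 2) ^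
            (1 / 2 : ℝ) *
          (∑' k : d → ℤ, (c k ^ (1 / 2 : ℝ) * ‖mFourierCoeff (EuclideanSpace.complexify ∘ w) k‖ₑ) ^ 2) ^
            (1 / 2 : ℝ) :=
        ennreal_tsum_mul_le_sqrt_mul_sqrt _ _
    _ = Torus.eGradNormSq v ^ (1 / 2 : ℝ) * Torus.eGradNormSq w ^ (1 / 2 : ℝ) := by
        rw [← eGradNormSq_eq_tsum_sq v, ← eGradNormSq_eq_tsum_sq w]

/-- **Spectral Green–Cauchy–Schwarz bound** (rough-vs-smooth), the registered stub `stub_greenCS` of the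
crux skeleton of `EnsembleRigidity.ResidualTransferSSS`: for `v ∈ L²(T^d; ℝ^d)` of finite spectral
enstrophy and smooth `w`, `|∫ ⟪v, Δw⟫| ≤ (‖∇v‖₂²)^{1/2} (∫ ∑ᵢ ‖∂ᵢw‖²)^{1/2}` (FMRT 2001, Ch. IV §1.1:
`(Au, v) = ((u, v))` for `u, v ∈ V = D(A^{1/2})`, and Cauchy–Schwarz; the real form of
`enorm_integral_inner_laplacian_le`, the smooth side converted by
`Torus.eGradNormSq_eq_ofReal_gradNormSq`). [folklore] -/
theorem stub_greenCS {v w : UnitAddTorus d → EuclideanSpace ℝ d} (hv : MemLp v 2 volume)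
    (hfin : Torus.eGradNormSq v ≠ ⊤) (hw : Torus.IsSmooth w) :
    |∫ x, ⟪v x, Torus.laplacian w x⟫_ℝ| ≤
      Real.sqrt (Torus.eGradNormSq v).toReal * Real.sqrt (Torus.gradNormSq w) := by
  have h := enorm_integral_inner_laplacian_le hv hw
  rw [Torus.eGradNormSq_eq_ofReal_gradNormSq hw] at h
  have hne : Torus.eGradNormSq v ^ (1 / 2 : ℝ) * ENNReal.ofReal (Torus.gradNormSq w) ^ (1 / 2 : ℝ) ≠ ⊤ :=
    ENNReal.mul_ne_top (ENNReal.rpow_ne_top_of_nonneg (by norm_num) hfin)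
      (ENNReal.rpow_ne_top_of_nonneg (by norm_num) ENNReal.ofReal_ne_top)
  rw [Real.enorm_eq_ofReal_abs, ENNReal.ofReal_le_iff_le_toReal hne] at h
  refine h.trans_eq ?_
  rw [ENNReal.toReal_mul, ← ENNReal.toReal_rpow, ← ENNReal.toReal_rpow,
    ENNReal.toReal_ofReal (Torus.gradNormSq_nonneg w), Real.sqrt_eq_rpow, Real.sqrt_eq_rpow]

end Summit.AnomalousDissipation.AnomalousDissipation.Theorems.ResidualTransferSSS

end
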